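import Mathlib
import Literature.NumberTheory.Sieve.LevelOfDistributionProofs
import Literature.NumberTheory.Sieve.SelbergSymmetryFormula
import Summits.Parity.GeneralizedHardyLittlewood.Theses.LiouvilleShiftedTables

/-!
# `PairsFromMAvg`, part 6: the inner sums `T_d = ∑_{M₀ < m ≤ K} log m · Λ(dm + h)` per modulus

Route `LiouvilleShiftedTables` (Parity / GeneralizedHardyLittlewood), support item stmt-Parity-14275
(`PairsFromMAvg`). For a modulus `d ≥ 1`:

* `sum_Icc_vonMangoldt_shift_eq` — `∑_{j ≤ m} Λ(dj + h) = ψ(dm + h; d, h) − ψ(h; d, h)`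
  (the tree's `shiftedPrimes_congrSum_eq`);
* `abs_sum_Icc_vonMangoldt_shift_sub_le` — for `(d, h) = 1`, `h ≥ 1`, `dm + h ≤ x`:
  `|∑_{j ≤ m} Λ(dj+h) − dm/φ(d)| ≤ 2 E*(x; d)` (`E*` = the tree's `primeAPError`);
* `abs_inner_sub_main_le` — Abel summation (`abs_sum_mul_le_of_monotone` of the tree):
  `|T_d − (d/φ(d)) ∑_{M₀ < m ≤ K} log m| ≤ 8 E*(x; d) log K` for `(d,h) = 1`, `dK + h ≤ x`;
* `abs_inner_le_of_not_coprime` — `|T_d| ≤ log K · log(dK + h)` for `(d, h) > 1`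
  (only prime powers of `p ∣ (d, h)` occur; the tree's `shiftedPrimes_congrSum_le_log`);
* `abs_sum_Icc_log_sub_le`, `abs_floor_mul_log_sub_le` — `∑_{m ≤ n} log m = n log n − n + O(log n + 1)`
  (Stirling, from the tree) and `|⌊r⌋ log⌊r⌋ − ⌊r⌋ − (r log r − r)| ≤ log r + 1`.

[folklore; cite: BombieriAsymptoticSieve1976, §1]
-/

noncomputable section

open Finset Real ArithmeticFunction Filter
open scoped ArithmeticFunction.Moebius

namespace Summit.Parity.GeneralizedHardyLittlewood.Theorems.PairsFromMAvg

open Literature.NumberTheory.Sieve (primeAPError primeAPError_nonneg abs_sub_le_primeAPError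
  shiftedPrimes_congrSum_le_log abs_sum_mul_le_of_monotone)
open Literature.NumberTheory.Sieve.LevelOfDistribution (chebyshevPsiMod)

/-! ### The progression sums `∑_{j ≤ m} Λ(dj + h)` -/

/-- `{n ≤ dm : d ∣ n, n > 0} = d · [1, m]` for `d ≥ 1`. [folklore] -/
theorem filter_dvd_Ioc_eq_map {d : ℕ} (hd : 0 < d) (m : ℕ) :
    (Ioc 0 (d * m)).filter (d ∣ ·) = (Icc 1 m).map ⟨(d * ·), mul_right_injective₀ hd.ne'⟩ := by
  ext n
  simp only [Finset.mem_filter, Finset.mem_Ioc, Finset.mem_map, Finset.mem_Icc,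
    Function.Embedding.coeFn_mk]
  constructor
  · rintro ⟨⟨hn0, hnm⟩, ⟨j, rfl⟩⟩
    refine ⟨j, ⟨?_, ?_⟩, rfl⟩
    · rcases Nat.eq_zero_or_pos j with rfl | hj
      · simp at hn0
      · exact hj
    · exact Nat.le_of_mul_le_mul_left hnm hd
  · rintro ⟨j, ⟨hj1, hjm⟩, rfl⟩
    exact ⟨⟨Nat.mul_pos hd hj1, Nat.mul_le_mul_left d hjm⟩, dvd_mul_right d j⟩

/-- `∑_{j ≤ m} Λ(dj + h) = A_d(dm)` is the congruence sum of the shifted primes, hence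
`= ψ(dm + h; d, h) − ψ(h; d, h)`. [folklore] -/
theorem sum_Icc_vonMangoldt_shift_eq {d : ℕ} (hd : 0 < d) (h m : ℕ) :
    ∑ j ∈ Icc 1 m, Λ (d * j + h) =
      chebyshevPsiMod d (h : ZMod d) ((d * m + h : ℕ) : ℝ) - chebyshevPsiMod d (h : ZMod d) h := by
  have e := Literature.NumberTheory.Sieve.SieveSequence.shiftedPrimes_congrSum_eq h d ((d * m : ℕ) : ℝ)
  rw [Nat.floor_natCast] at e
  rw [← e]
  simp only [Literature.NumberTheory.Sieve.SieveSequence.congrSum,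
    Literature.NumberTheory.Sieve.SieveSequence.shiftedPrimes, Nat.floor_natCast]
  rw [filter_dvd_Ioc_eq_map hd, Finset.sum_map]
  rfl

/-- For `(d, h) = 1`, `h ≥ 1` and `dm + h ≤ x`: `|∑_{j ≤ m} Λ(dj+h) − dm/φ(d)| ≤ 2 E*(x; d)`
(each of `ψ(dm+h; d, h) − (dm+h)/φ(d)` and `ψ(h; d, h) − h/φ(d)` is at most `E*`). [folklore] -/
theorem abs_sum_Icc_vonMangoldt_shift_sub_le {d h : ℕ} (hd : 0 < d) (hh : 1 ≤ h)
    (hcop : d.Coprime h) (m : ℕ) {x : ℝ} (hx : ((d * m + h : ℕ) : ℝ) ≤ x) :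
    |∑ j ∈ Icc 1 m, Λ (d * j + h) - (d : ℝ) * m / Nat.totient d| ≤ 2 * primeAPError x d := by
  rw [sum_Icc_vonMangoldt_shift_eq hd]
  set u : (ZMod d)ˣ := ZMod.unitOfCoprime h hcop.symm with hu
  have hu' : ((u : ZMod d)) = (h : ZMod d) := ZMod.coe_unitOfCoprime h hcop.symm
  have hh1 : (1 : ℝ) ≤ h := by exact_mod_cast hh
  have hy1 : (1 : ℝ) ≤ ((d * m + h : ℕ) : ℝ) := by exact_mod_cast le_add_left hh
  have hhx : (h : ℝ) ≤ x := le_trans (by exact_mod_cast Nat.le_add_left h (d * m)) hx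
  have e1 := abs_sub_le_primeAPError (x := x) hd.ne' hy1 hx u
  have e2 := abs_sub_le_primeAPError (x := x) hd.ne' hh1 hhx u
  rw [hu'] at e1 e2
  have hsplit : chebyshevPsiMod d (h : ZMod d) ((d * m + h : ℕ) : ℝ) - chebyshevPsiMod d (h : ZMod d) h -
      (d : ℝ) * m / Nat.totient d =
      (chebyshevPsiMod d (h : ZMod d) ((d * m + h : ℕ) : ℝ) - ((d * m + h : ℕ) : ℝ) / Nat.totient d) -
      (chebyshevPsiMod d (h : ZMod d) h - (h : ℝ) / Nat.totient d) := by
    push_cast; ring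
  rw [hsplit]
  calc _ ≤ |chebyshevPsiMod d (h : ZMod d) ((d * m + h : ℕ) : ℝ) - ((d * m + h : ℕ) : ℝ) / Nat.totient d| +
        |chebyshevPsiMod d (h : ZMod d) h - (h : ℝ) / Nat.totient d| := abs_sub _ _
    _ ≤ primeAPError x d + primeAPError x d := add_le_add e1 e2
    _ = 2 * primeAPError x d := by ring

/-! ### Abel summation for `T_d` -/

/-- `∑_{M₀ < m ≤ K} f(m) = ∑_{k < K − M₀} f(M₀ + 1 + k)`. [folklore] -/
theorem sum_Ioc_eq_sum_range' {M : Type*} [AddCommMonoid M] (f : ℕ → M) (M₀ K : ℕ) :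
    ∑ m ∈ Ioc M₀ K, f m = ∑ k ∈ Finset.range (K - M₀), f (M₀ + 1 + k) := by
  have e : Ioc M₀ K = Ico (M₀ + 1) (K + 1) := by ext; simp
  rw [e, Finset.sum_Ico_eq_sum_range, show K + 1 - (M₀ + 1) = K - M₀ by omega]

/-- **Abel summation for the inner sum.** For `(d, h) = 1`, `d, h ≥ 1` and `dK + h ≤ x`:
`|∑_{M₀ < m ≤ K} log m (Λ(dm+h) − d/φ(d))| ≤ 8 E*(x; d) log K` (the partial sums of
`Λ(dm+h) − d/φ(d)` over `M₀ < m ≤ M` are differences of two remainders, each `≤ 2E*` by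
`abs_sum_Icc_vonMangoldt_shift_sub_le`; then the tree's `abs_sum_mul_le_of_monotone`).
[cite: BombieriAsymptoticSieve1976, §1] -/
theorem abs_inner_sub_main_le {d h : ℕ} (hd : 0 < d) (hh : 1 ≤ h) (hcop : d.Coprime h)
    (M₀ K : ℕ) {x : ℝ} (hx : ((d * K + h : ℕ) : ℝ) ≤ x) :
    |∑ m ∈ Ioc M₀ K, Real.log m * Λ (d * m + h) -
        (d : ℝ) / Nat.totient d * ∑ m ∈ Ioc M₀ K, Real.log m| ≤
      8 * primeAPError x d * Real.log K := by
  have hE := primeAPError_nonneg x d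
  rcases le_or_gt K M₀ with hKM | hKM
  · rw [Finset.Ioc_eq_empty (by omega), Finset.sum_empty, Finset.sum_empty, mul_zero, sub_zero,
      abs_zero]
    exact mul_nonneg (by linarith) (Real.log_natCast_nonneg K)
  -- reindex `m = M₀ + 1 + k`, `k < n + 1`, `n = K - M₀ - 1`
  obtain ⟨n, hn⟩ : ∃ n, K - M₀ = n + 1 := ⟨K - M₀ - 1, by omega⟩
  have hKn : M₀ + 1 + n = K := by omega
  set c : ℕ → ℝ := fun k => Λ (d * (M₀ + 1 + k) + h) - (d : ℝ) / Nat.totient d with hc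
  set f : ℕ → ℝ := fun k => Real.log ((M₀ + 1 + k : ℕ) : ℝ) with hf
  have hre : ∑ m ∈ Ioc M₀ K, Real.log m * Λ (d * m + h) -
      (d : ℝ) / Nat.totient d * ∑ m ∈ Ioc M₀ K, Real.log m =
      ∑ k ∈ Finset.range (n + 1), c k * f k := by
    rw [Finset.mul_sum, ← Finset.sum_sub_distrib, sum_Ioc_eq_sum_range', hn]
    refine Finset.sum_congr rfl fun k _ => ?_
    simp only [hc, hf]
    ring
  rw [hre]
  -- partial sums of `c`
  have hpartial : ∀ n' ≤ n, |∑ k ∈ Finset.range (n' + 1), c k| ≤ 4 * primeAPError x d := by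
    intro n' hn'
    have hsumc : ∑ k ∈ Finset.range (n' + 1), c k =
        (∑ j ∈ Icc 1 (M₀ + 1 + n'), Λ (d * j + h) - (d : ℝ) * (M₀ + 1 + n' : ℕ) / Nat.totient d) -
        (∑ j ∈ Icc 1 M₀, Λ (d * j + h) - (d : ℝ) * M₀ / Nat.totient d) := by
      have hIcc : ∑ j ∈ Icc 1 (M₀ + 1 + n'), Λ (d * j + h) =
          ∑ j ∈ Icc 1 M₀, Λ (d * j + h) + ∑ j ∈ Ioc M₀ (M₀ + 1 + n'), Λ (d * j + h) := by
        have e1 : Icc 1 (M₀ + 1 + n') = Ioc 0 (M₀ + 1 + n') := by ext; simp; omega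
        have e2 : Icc 1 M₀ = Ioc 0 M₀ := by ext; simp; omega
        rw [e1, e2, Finset.sum_Ioc_consecutive _ (Nat.zero_le _) (by omega)]
      rw [hIcc, sum_Ioc_eq_sum_range', show M₀ + 1 + n' - M₀ = n' + 1 by omega]
      simp only [hc]
      rw [Finset.sum_sub_distrib, Finset.sum_const, Finset.card_range, nsmul_eq_mul]
      push_cast
      ring
    rw [hsumc]
    have hx1 : ((d * (M₀ + 1 + n') + h : ℕ) : ℝ) ≤ x := by
      refine le_trans ?_ hx
      exact_mod_cast Nat.add_le_add_right (Nat.mul_le_mul_left d (by omega)) h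
    have hx2 : ((d * M₀ + h : ℕ) : ℝ) ≤ x := by
      refine le_trans ?_ hx
      exact_mod_cast Nat.add_le_add_right (Nat.mul_le_mul_left d (by omega)) h
    have b1 := abs_sum_Icc_vonMangoldt_shift_sub_le hd hh hcop (M₀ + 1 + n') hx1
    have b2 := abs_sum_Icc_vonMangoldt_shift_sub_le hd hh hcop M₀ hx2
    calc _ ≤ |∑ j ∈ Icc 1 (M₀ + 1 + n'), Λ (d * j + h) - (d : ℝ) * (M₀ + 1 + n' : ℕ) / Nat.totient d| +
          |∑ j ∈ Icc 1 M₀, Λ (d * j + h) - (d : ℝ) * M₀ / Nat.totient d| := abs_sub _ _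
      _ ≤ 2 * primeAPError x d + 2 * primeAPError x d := add_le_add b1 b2
      _ = 4 * primeAPError x d := by ring
  have hfmono : ∀ k, f k ≤ f (k + 1) := by
    intro k
    simp only [hf]
    exact Real.log_le_log (by positivity) (by push_cast; linarith)
  have hf0 : ∀ k, 0 ≤ f k := fun k => Real.log_natCast_nonneg _
  have key := abs_sum_mul_le_of_monotone c f (4 * primeAPError x d) n hpartial hfmono hf0
  calc _ ≤ 2 * (4 * primeAPError x d) * f n := key
    _ = 8 * primeAPError x d * Real.log K := by simp only [hf]; rw [hKn]; ring

/-! ### The moduli not coprime to `h` -/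

/-- For `(d, h) > 1`, `d ≥ 1`, `h ≠ 0`: `|T_d| ≤ log K · log(dK + h)` (all `dm + h` with `Λ ≠ 0` are
powers of one prime `p ∣ (d, h)`). [folklore] -/
theorem abs_inner_le_of_not_coprime {d h : ℕ} (hd : 0 < d) (hh : h ≠ 0) (hcop : ¬ d.Coprime h)
    (M₀ K : ℕ) :
    |∑ m ∈ Ioc M₀ K, Real.log m * Λ (d * m + h)| ≤ Real.log K * Real.log ((d * K + h : ℕ) : ℝ) := by
  obtain ⟨p, hp, hpd, hph⟩ := Nat.Prime.not_coprime_iff_dvd.mp hcop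
  have hnn : ∀ m ∈ Ioc M₀ K, 0 ≤ Real.log m * Λ (d * m + h) := fun m _ =>
    mul_nonneg (Real.log_natCast_nonneg m) vonMangoldt_nonneg
  rw [abs_of_nonneg (Finset.sum_nonneg hnn)]
  have hlogK : 0 ≤ Real.log K := Real.log_natCast_nonneg K
  calc ∑ m ∈ Ioc M₀ K, Real.log m * Λ (d * m + h)
      ≤ ∑ m ∈ Ioc M₀ K, Real.log K * Λ (d * m + h) := by
        refine Finset.sum_le_sum fun m hm => ?_
        have hmK : (m : ℝ) ≤ K := by exact_mod_cast (Finset.mem_Ioc.mp hm).2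
        have hm0 : (0 : ℝ) < m := by exact_mod_cast (show 0 < m by have := (Finset.mem_Ioc.mp hm).1; omega)
        exact mul_le_mul_of_nonneg_right (Real.log_le_log hm0 hmK) vonMangoldt_nonneg
    _ = Real.log K * ∑ m ∈ Ioc M₀ K, Λ (d * m + h) := (Finset.mul_sum _ _ _).symm
    _ ≤ Real.log K * ∑ m ∈ Icc 1 K, Λ (d * m + h) := by
        refine mul_le_mul_of_nonneg_left ?_ hlogK
        refine Finset.sum_le_sum_of_subset_of_nonneg (fun m hm => ?_) fun _ _ _ => vonMangoldt_nonneg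
        rw [Finset.mem_Ioc] at hm; rw [Finset.mem_Icc]; omega
    _ = Real.log K * (Literature.NumberTheory.Sieve.SieveSequence.shiftedPrimes h).congrSum d
          ((d * K : ℕ) : ℝ) := by
        congr 1
        simp only [Literature.NumberTheory.Sieve.SieveSequence.congrSum,
          Literature.NumberTheory.Sieve.SieveSequence.shiftedPrimes, Nat.floor_natCast]
        rw [filter_dvd_Ioc_eq_map hd, Finset.sum_map]
        rfl
    _ ≤ Real.log K * Real.log ((d * K + h : ℕ) : ℝ) := by
        refine mul_le_mul_of_nonneg_left ?_ hlogK
        have := shiftedPrimes_congrSum_le_log hh hp hpd hph ((d * K : ℕ) : ℝ)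
        rwa [Nat.floor_natCast] at this

/-! ### `∑_{m ≤ n} log m = n log n − n + O(log n + 1)` -/

/-- `|∑_{m ≤ n} log m − (n log n − n)| ≤ log n + 1` (Stirling; the tree's `log_factorial_ge`,
`log_factorial_le`). [folklore] -/
theorem abs_sum_Icc_log_sub_le (n : ℕ) :
    |∑ m ∈ Icc 1 n, Real.log m - ((n : ℝ) * Real.log n - n)| ≤ Real.log n + 1 := by
  rcases Nat.eq_zero_or_pos n with rfl | hn
  · simp
  have e : ∑ m ∈ Icc 1 n, Real.log (m : ℝ) = Real.log (Nat.factorial n : ℝ) := by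
    rw [Literature.NumberTheory.Sieve.SelbergSymmetry.log_factorial_eq_sum_log]
    have : Icc 1 n = Ioc 0 n := by ext; simp; omega
    rw [this]
  rw [e]
  have h1 := Literature.NumberTheory.Sieve.SelbergSymmetry.log_factorial_ge hn.ne'
  have h2 := Literature.NumberTheory.Sieve.SelbergSymmetry.log_factorial_le n
  have hlog : 0 ≤ Real.log n := Real.log_natCast_nonneg n
  rw [abs_le]
  constructor <;> linarith

/-- `∑_{M₀ < m ≤ K} log m = ∑_{m ≤ K} log m − ∑_{m ≤ M₀} log m` for `M₀ ≤ K`. [folklore] -/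
theorem sum_Ioc_log_eq_sub {M₀ K : ℕ} (h : M₀ ≤ K) :
    ∑ m ∈ Ioc M₀ K, Real.log (m : ℝ) =
      ∑ m ∈ Icc 1 K, Real.log (m : ℝ) - ∑ m ∈ Icc 1 M₀, Real.log (m : ℝ) := by
  have e1 : Icc 1 K = Ioc 0 K := by ext; simp; omega
  have e2 : Icc 1 M₀ = Ioc 0 M₀ := by ext; simp; omega
  rw [e1, e2, ← Finset.sum_Ioc_consecutive _ (Nat.zero_le M₀) h]
  ring

/-- `|(⌊r⌋ log⌊r⌋ − ⌊r⌋) − (r log r − r)| ≤ log r + 1` for `r ≥ 1` (`t ↦ t log t − t` has derivative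
`log t ∈ [0, log r]` on `[⌊r⌋, r]`; elementary via `log(r/q) ≤ r/q − 1`). [folklore] -/
theorem abs_floor_mul_log_sub_le {r : ℝ} (hr : 1 ≤ r) :
    |((⌊r⌋₊ : ℝ) * Real.log (⌊r⌋₊ : ℝ) - ⌊r⌋₊) - (r * Real.log r - r)| ≤ Real.log r + 1 := by
  set q : ℕ := ⌊r⌋₊ with hq
  have hr0 : 0 < r := by linarith
  have hq1 : 1 ≤ q := Nat.le_floor (by exact_mod_cast hr)
  have hq0 : (0 : ℝ) < q := by exact_mod_cast hq1
  have hqr : (q : ℝ) ≤ r := Nat.floor_le hr0.le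
  have hrq : r < q + 1 := Nat.lt_floor_add_one r
  have hlogr : 0 ≤ Real.log r := Real.log_nonneg hr
  have hlogq : Real.log q ≤ Real.log r := Real.log_le_log hq0 hqr
  -- `0 ≤ q (log r − log q) ≤ r − q`
  have h1 : 0 ≤ (q : ℝ) * (Real.log r - Real.log q) := mul_nonneg hq0.le (by linarith)
  have h2 : (q : ℝ) * (Real.log r - Real.log q) ≤ r - q := by
    have : Real.log r - Real.log q = Real.log (r / q) := (Real.log_div hr0.ne' hq0.ne').symm
    rw [this]
    have h3 : Real.log (r / q) ≤ r / q - 1 := Real.log_le_sub_one_of_pos (by positivity)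
    calc (q : ℝ) * Real.log (r / q) ≤ q * (r / q - 1) := mul_le_mul_of_nonneg_left h3 hq0.le
      _ = r - q := by field_simp
  -- `r log r − q log q = (r − q) log r + q (log r − log q)`
  have h4 : 0 ≤ (r - q) * Real.log r := mul_nonneg (by linarith) hlogr
  have h5 : (r - q) * Real.log r ≤ Real.log r := by nlinarith
  rw [abs_le]
  constructor <;> nlinarith

end Summit.Parity.GeneralizedHardyLittlewood.Theorems.PairsFromMAvg
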